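/-
Copyright: the b2b-balaban T⁴-continuum CRUX team, row NE7b OWNER lineage `t4-ne7b-p1` (gen 126). Project licence.
-/
import Summits.QuantumFields.BalabanUV.T4Continuum.Spine.NE7b.SupZdCouplingShiftColumn

/-!
# THE COUPLING IS AN ADDITIVE SHIFT OF THE NEXT-SCALE HESSIAN: on `ℤ^d`, for the `H + K` column at two block-spin couplings `a, a′`
# (same mesh `n`, potential `V`, kernel `K`; `ε := a′ − a` of EITHER sign and ANY size), the coarse matrices and next-scale Hessians are
# related EXACTLY by `T_a = T_{a′} + εT_{a′}T_a`, `T_{a′}(N_a + ε·1) = 1`, hence `N_{a′} = N_a + ε·1` — the dependence of the Hessian on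
# the coupling is EXPLICIT, every decay ∕ off-diagonal statement about `N_a` holds VERBATIM for `N_{a′}`, the diagonal moves by `ε`;
# the answer to the located a-uniformity audit (§ [NE7bP1-G125-HANDOFF] NEXT (3)(a)) for the Hessian: no re-threading of constants, no
# `L`-column (row NE7b, node U5c; (258) + (203)∕(234)∕(245) BY NAME; [folklore] — the operator form of «resistances add»,
# [Balaban1982Higgs1] (2.13), (252)∕(255) and `SoftStepSemigroup` in the tree)

Cell `pub-balaban`, sub-cell `t4`, spine estimate NE7b (`T4WeightBudget.RelWeightBound`; the cell's OWN estimate — NOT PRINTED in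
[Bałaban 1983–89], NOT PROVED).  Crux-route work under `Spine/NE7b/` by the row OWNER (`t4-ne7b-p1` gen 126, file (259)) under FREEZE
(0)'s crux-prover clause, on § [NE7bP1-G125-HANDOFF] NEXT (3)(a) (the a-uniformity audit; see (258)'s header); NOTHING of Bałaban's is
named as a Lean object, valued or asserted; no `T4Continuum/Support` leaf typed; no `def`, no notation (the columns at the two couplings,
their coarse matrices and the inverses are ANY data with the displayed clauses — (216)∕(222)∕(246) supply them at each coupling, (237) (U) and
(222) (C5) the two uniqueness clauses); zero `sorry`.  Imports (BY NAME): the OWNER's (258) `…SupZdCouplingShiftColumn`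
(`coupling_shift_column`; through it (203) `kernel_comp_apply` — re-association of decaying kernels on a bounded column, (245) `conv_term_le`,
(234) `coarse_entry_le`, (189) `summable_exp_l1`, (191) `natAbs_sub_comm_sum`).

WHY (located).  (258) §2 gives the column identity `Ψ^a_c = Ψ^{a′}_c + εΣ′_bT_a(b,c)Ψ^{a′}_b`.  Block means (finite sums through the absolutely
convergent series) give the COARSE IDENTITY `T_a = T_{a′} + εT_{a′}T_a` (§1); for a decaying right inverse `N` of `T_a`, substituting the
coarse identity into `Σ′_cT_{a′}(b′,c)N(c,c′)` and re-associating the triple product ((203), the composed kernel `T_{a′}T_a` decays by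
(214)'s no-loss convolution) gives `T_{a′}N = 1 − εT_{a′}`, i.e. `T_{a′}(N + ε·1) = 1` (§2); `N + ε·1` decays with constant `C_N + |ε|`, so
uniqueness of decaying right inverses of `T_{a′}` ((222) (C5)) identifies `N_{a′} = N_a + ε·1` (§3).  CONSEQUENCE FOR THE AUDIT: the
next-scale Hessian `(n+1)^dN` at ANY coupling of the window `(a(1 − (n+1)^{−d}), a]` is the one at the reference coupling plus an explicit
multiple of the identity — decay constants, Lipschitz constants in `(V, K)`, torus limits and symmetry are those of the reference coupling
VERBATIM; only the floor moves, by exactly `ε`.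

WHAT IS PROVED ([folklore]; every mesh `n`, ANY `a, a′ : ℝ`, ANY `V`, kernel `|K(p,q)| ≤ εe^{−γ|p−q|₁}`):
* §1 **`coupling_shift_coarse`** (`b ↦ T_{a′}(b′,b)T_a(b,c)` summable and `T_a(b′,c) = T_{a′}(b′,c) + (a′−a)Σ′_bT_{a′}(b′,b)T_a(b,c)`).
* §2 **`coupling_shift_right_inverse`** (ANY decaying `N` with `T_aN = 1` ⟹ `Σ′_cT_{a′}(b′,c)(N(c,c′) + (a′−a)δ_{cc′}) = δ_{b′c′}`, summable).
* §3 THE END **`coupling_shift_inverse`** (with (222) (C5)'s uniqueness of decaying right inverses at `a′`: `N_{a′}(b,c) = N_a(b,c) + (a′−a)δ_{bc}`).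
* §4 toy.

HONEST (what this is NOT).  Kernel algebra for ANY objects with the displayed clauses; existence of the columns at both couplings and the two
uniqueness clauses are INPUTS (each coupling needs its own smallness of `K` relative to its own constants); the identity moves the FLOOR of
`N` by `ε` (a window of couplings needs `|ε|` against the floor, or the floor taken at the smallest coupling); the block columns at `a′` are
expressed through those at `a` and `T_{a′} = (N_a + ε)⁻¹`, whose profile constants this file does not value; scalar skeleton ((A3), NC-NE7b-α
UNRULED); nothing of the torus; nothing of the covariant propagators of [B4]–[B6]; nothing of Bałaban's asserted.  BY-NAME EFFECT ON THE
WALL: NONE.  NE7b NOT PRINTED ∕ NOT PROVED; spine PROVED 0∕9; rung (B)+1 — the programme's measures remain FINITE-torus statements; NOT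
the mass gap, NOT Clay.  HONEST DEPENDENCY: continuum YM on T⁴ ⇐ BetaPertH ∧ nine spine estimates (0∕9 proved); BetaPertH ⇐ (D1) ∧ (D4) ∧
CAP+tail; G-an2-4 gates asym, D1 and NE2∕3∕4.
-/

set_option autoImplicit false

noncomputable section

namespace Summit.QuantumFields.BalabanUV.T4Continuum.NE7b.SupZdCouplingShift

open Real Filter Topology
open Literature.MathematicalPhysics.QuantumFieldTheory.Balaban1983to89
open B6QGQLower276 (X e blk B mem_B sum_B_const)
open SupZdExponentialSums (summable_exp_l1 summable_kernel_row)
open SupZdCoarseForm (natAbs_sub_comm_sum)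
open SupZdCoarseInverseOperator (kernel_comp_apply)
open SupZdKernelResponseLipschitz (conv_term_le)
open SupZdPerturbedCoarseForm (coarse_entry_le)
open SupZdCouplingShiftColumn (coupling_shift_column)

variable {d : ℕ}

/-! ## §1. The coarse identity `T_a = T_{a′} + (a′ − a)T_{a′}T_a` -/

/-- **THE COUPLING SHIFT OF THE COARSE MATRICES**: with everything as in (258) §2 and `T_a(b,c) = (n+1)^{−d}Σ_{B n b}Ψ_c`, `T_{a′}(b,c) =
(n+1)^{−d}Σ_{B n b}Ψ′_c`: for all `b′, c`, `b ↦ T_{a′}(b′,b)T_a(b,c)` is summable and `T_a(b′,c) = T_{a′}(b′,c) + (a′ − a)Σ′_bT_{a′}(b′,b)T_a(b,c)` —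
the block means of (258) §2's identity. [folklore] -/
theorem coupling_shift_coarse (n : ℕ) (a a' : ℝ) {ε γ μ ν CΨ CΨ' : ℝ} (hε : 0 ≤ ε) (hγ : 0 < γ) (hν : 0 < ν) (hνμ : ν < μ)
    (V : X d → ℝ) (K : X d → X d → ℝ) (hK : ∀ p q, |K p q| ≤ ε * exp (-(γ * ∑ i, (((p i - q i).natAbs : ℕ) : ℝ))))
    (Ψ : X d → X d → ℝ) (hΨd : ∀ c p, |Ψ c p| ≤ CΨ * exp (-(μ * ∑ i, (((blk n p i - c i).natAbs : ℕ) : ℝ))))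
    (hΨ : ∀ c p, ((n : ℝ) + 1) ^ 2 * ∑ μ', (2 * Ψ c p - Ψ c (p + e μ') - Ψ c (p - e μ'))
        + a / ((n : ℝ) + 1) ^ d * ∑ q ∈ B n (blk n p), Ψ c q + V p * Ψ c p + ∑' q : X d, K p q * Ψ c q
          = if blk n p = c then 1 else 0)
    (Ψ' : X d → X d → ℝ) (hΨ'd : ∀ c p, |Ψ' c p| ≤ CΨ' * exp (-(μ * ∑ i, (((blk n p i - c i).natAbs : ℕ) : ℝ))))
    (hΨ' : ∀ c p, ((n : ℝ) + 1) ^ 2 * ∑ μ', (2 * Ψ' c p - Ψ' c (p + e μ') - Ψ' c (p - e μ'))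
        + a' / ((n : ℝ) + 1) ^ d * ∑ q ∈ B n (blk n p), Ψ' c q + V p * Ψ' c p + ∑' q : X d, K p q * Ψ' c q
          = if blk n p = c then 1 else 0)
    (hU : ∀ (f : X d → ℝ) (Mf : ℝ), (∀ p, |f p| ≤ Mf) → ∀ (u v : X d → ℝ) (Bu Bv : ℝ), (∀ p, |u p| ≤ Bu) → (∀ p, |v p| ≤ Bv) →
        (∀ p, ((n : ℝ) + 1) ^ 2 * ∑ μ', (2 * u p - u (p + e μ') - u (p - e μ'))
          + a' / ((n : ℝ) + 1) ^ d * ∑ q ∈ B n (blk n p), u q + V p * u p + ∑' q : X d, K p q * u q = f p) →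
        (∀ p, ((n : ℝ) + 1) ^ 2 * ∑ μ', (2 * v p - v (p + e μ') - v (p - e μ'))
          + a' / ((n : ℝ) + 1) ^ d * ∑ q ∈ B n (blk n p), v q + V p * v p + ∑' q : X d, K p q * v q = f p) →
        ∀ p, u p = v p)
    (b' c : X d) :
    Summable (fun b : X d => ((((n : ℝ) + 1) ^ d)⁻¹ * ∑ q ∈ B n b', Ψ' b q) * ((((n : ℝ) + 1) ^ d)⁻¹ * ∑ q ∈ B n b, Ψ c q)) ∧
    (((n : ℝ) + 1) ^ d)⁻¹ * ∑ q ∈ B n b', Ψ c q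
      = (((n : ℝ) + 1) ^ d)⁻¹ * ∑ q ∈ B n b', Ψ' c q
        + (a' - a) * ∑' b : X d, ((((n : ℝ) + 1) ^ d)⁻¹ * ∑ q ∈ B n b', Ψ' b q) * ((((n : ℝ) + 1) ^ d)⁻¹ * ∑ q ∈ B n b, Ψ c q) := by
  classical
  have hcol := fun p => coupling_shift_column n a a' hε hγ hν hνμ V K hK Ψ hΨd hΨ Ψ' hΨ'd hΨ' hU c p
  have hs : ∀ p, Summable (fun b : X d => ((((n : ℝ) + 1) ^ d)⁻¹ * ∑ q ∈ B n b, Ψ c q) * Ψ' b p) := fun p => (hcol p).1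
  -- summability of the coarse product: a finite sum of summable families
  have hsum : Summable (fun b : X d => ∑ q ∈ B n b', ((((n : ℝ) + 1) ^ d)⁻¹ * ∑ q' ∈ B n b, Ψ c q') * Ψ' b q) :=
    summable_sum fun q _ => hs q
  have e : ∀ b : X d, ((((n : ℝ) + 1) ^ d)⁻¹ * ∑ q ∈ B n b', Ψ' b q) * ((((n : ℝ) + 1) ^ d)⁻¹ * ∑ q ∈ B n b, Ψ c q)
      = (((n : ℝ) + 1) ^ d)⁻¹ * ∑ q ∈ B n b', ((((n : ℝ) + 1) ^ d)⁻¹ * ∑ q' ∈ B n b, Ψ c q') * Ψ' b q := fun b => by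
    have h : ∑ q ∈ B n b', ((((n : ℝ) + 1) ^ d)⁻¹ * ∑ q' ∈ B n b, Ψ c q') * Ψ' b q
        = ((((n : ℝ) + 1) ^ d)⁻¹ * ∑ q' ∈ B n b, Ψ c q') * ∑ q ∈ B n b', Ψ' b q := by rw [← Finset.mul_sum]
    rw [h]; ring
  refine ⟨(hsum.mul_left _).congr fun b => (e b).symm, ?_⟩
  -- the tsum term with the finite block sum outside
  have key : ∑' b : X d, ((((n : ℝ) + 1) ^ d)⁻¹ * ∑ q ∈ B n b', Ψ' b q) * ((((n : ℝ) + 1) ^ d)⁻¹ * ∑ q ∈ B n b, Ψ c q)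
      = (((n : ℝ) + 1) ^ d)⁻¹ * ∑ q ∈ B n b', ∑' b : X d, ((((n : ℝ) + 1) ^ d)⁻¹ * ∑ q' ∈ B n b, Ψ c q') * Ψ' b q := by
    rw [← Summable.tsum_finsetSum (fun q _ => hs q), ← tsum_mul_left]
    exact tsum_congr fun b => (e b)
  have hL : ∑ q ∈ B n b', Ψ c q
      = ∑ q ∈ B n b', Ψ' c q + (a' - a) * ∑ q ∈ B n b', ∑' b : X d, ((((n : ℝ) + 1) ^ d)⁻¹ * ∑ q' ∈ B n b, Ψ c q') * Ψ' b q := by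
    rw [Finset.mul_sum, ← Finset.sum_add_distrib]
    exact Finset.sum_congr rfl fun q _ => (hcol q).2
  rw [key, hL]
  ring

/-! ## §2. A right inverse at coupling `a`, shifted, is a right inverse at coupling `a′` -/

/-- **`T_{a′}(N_a + (a′ − a)·1) = 1`**: with everything as in §1 and ANY `N` with `|N(b,c)| ≤ C_Ne^{−ν_N|b−c|₁}` and `Σ′_cT_a(b,c)N(c,c′) = δ_{bc′}`:
for all `b′, c′`, `c ↦ T_{a′}(b′,c)(N(c,c′) + (a′−a)δ_{cc′})` is summable and sums to `δ_{b′c′}` — §1 inside the sum, (203)'s re-association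
`Σ′_c(Σ′_bT_{a′}(b′,b)T_a(b,c))N(c,c′) = Σ′_bT_{a′}(b′,b)Σ′_cT_a(b,c)N(c,c′) = T_{a′}(b′,c′)`. [folklore] -/
theorem coupling_shift_right_inverse (n : ℕ) (a a' : ℝ) {ε γ μ ν CΨ CΨ' CN νN : ℝ} (hε : 0 ≤ ε) (hγ : 0 < γ) (hν : 0 < ν)
    (hνμ : ν < μ) (hνN : 0 < νN)
    (V : X d → ℝ) (K : X d → X d → ℝ) (hK : ∀ p q, |K p q| ≤ ε * exp (-(γ * ∑ i, (((p i - q i).natAbs : ℕ) : ℝ))))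
    (Ψ : X d → X d → ℝ) (hΨd : ∀ c p, |Ψ c p| ≤ CΨ * exp (-(μ * ∑ i, (((blk n p i - c i).natAbs : ℕ) : ℝ))))
    (hΨ : ∀ c p, ((n : ℝ) + 1) ^ 2 * ∑ μ', (2 * Ψ c p - Ψ c (p + e μ') - Ψ c (p - e μ'))
        + a / ((n : ℝ) + 1) ^ d * ∑ q ∈ B n (blk n p), Ψ c q + V p * Ψ c p + ∑' q : X d, K p q * Ψ c q
          = if blk n p = c then 1 else 0)
    (Ψ' : X d → X d → ℝ) (hΨ'd : ∀ c p, |Ψ' c p| ≤ CΨ' * exp (-(μ * ∑ i, (((blk n p i - c i).natAbs : ℕ) : ℝ))))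
    (hΨ' : ∀ c p, ((n : ℝ) + 1) ^ 2 * ∑ μ', (2 * Ψ' c p - Ψ' c (p + e μ') - Ψ' c (p - e μ'))
        + a' / ((n : ℝ) + 1) ^ d * ∑ q ∈ B n (blk n p), Ψ' c q + V p * Ψ' c p + ∑' q : X d, K p q * Ψ' c q
          = if blk n p = c then 1 else 0)
    (hU : ∀ (f : X d → ℝ) (Mf : ℝ), (∀ p, |f p| ≤ Mf) → ∀ (u v : X d → ℝ) (Bu Bv : ℝ), (∀ p, |u p| ≤ Bu) → (∀ p, |v p| ≤ Bv) →
        (∀ p, ((n : ℝ) + 1) ^ 2 * ∑ μ', (2 * u p - u (p + e μ') - u (p - e μ'))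
          + a' / ((n : ℝ) + 1) ^ d * ∑ q ∈ B n (blk n p), u q + V p * u p + ∑' q : X d, K p q * u q = f p) →
        (∀ p, ((n : ℝ) + 1) ^ 2 * ∑ μ', (2 * v p - v (p + e μ') - v (p - e μ'))
          + a' / ((n : ℝ) + 1) ^ d * ∑ q ∈ B n (blk n p), v q + V p * v p + ∑' q : X d, K p q * v q = f p) →
        ∀ p, u p = v p)
    (N : X d → X d → ℝ) (hNd : ∀ b c, |N b c| ≤ CN * exp (-(νN * ∑ i, (((b i - c i).natAbs : ℕ) : ℝ))))
    (hTN : ∀ b c', ∑' c : X d, ((((n : ℝ) + 1) ^ d)⁻¹ * ∑ q ∈ B n b, Ψ c q) * N c c' = if b = c' then 1 else 0)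
    (b' c' : X d) :
    Summable (fun c : X d => ((((n : ℝ) + 1) ^ d)⁻¹ * ∑ q ∈ B n b', Ψ' c q) * (N c c' + (a' - a) * (if c = c' then 1 else 0))) ∧
    ∑' c : X d, ((((n : ℝ) + 1) ^ d)⁻¹ * ∑ q ∈ B n b', Ψ' c q) * (N c c' + (a' - a) * (if c = c' then 1 else 0))
      = if b' = c' then 1 else 0 := by
  classical
  have hS0 : ∀ b c : X d, (0 : ℝ) ≤ ∑ i, (((b i - c i).natAbs : ℕ) : ℝ) := fun _ _ => by positivity
  have hCΨ : 0 ≤ CΨ := by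
    have h := (abs_nonneg _).trans (hΨd c' 0); exact le_of_mul_le_mul_right (by rw [zero_mul]; exact h) (exp_pos _)
  have hCΨ' : 0 ≤ CΨ' := by
    have h := (abs_nonneg _).trans (hΨ'd c' 0); exact le_of_mul_le_mul_right (by rw [zero_mul]; exact h) (exp_pos _)
  have hCN : 0 ≤ CN := by
    have h := (abs_nonneg _).trans (hNd c' c'); exact le_of_mul_le_mul_right (by rw [zero_mul]; exact h) (exp_pos _)
  -- the two coarse matrices as kernels, their profiles
  obtain ⟨T, hT⟩ : ∃ T : X d → X d → ℝ, ∀ b c, T b c = (((n : ℝ) + 1) ^ d)⁻¹ * ∑ q ∈ B n b, Ψ c q := ⟨_, fun _ _ => rfl⟩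
  obtain ⟨T', hT'⟩ : ∃ T' : X d → X d → ℝ, ∀ b c, T' b c = (((n : ℝ) + 1) ^ d)⁻¹ * ∑ q ∈ B n b, Ψ' c q := ⟨_, fun _ _ => rfl⟩
  have hTd : ∀ b c, |T b c| ≤ CΨ * exp (-(μ * ∑ i, (((b i - c i).natAbs : ℕ) : ℝ))) := fun b c => by
    rw [hT]; exact coarse_entry_le n Ψ c (hΨd c) b
  have hT'd : ∀ b c, |T' b c| ≤ CΨ' * exp (-(μ * ∑ i, (((b i - c i).natAbs : ℕ) : ℝ))) := fun b c => by
    rw [hT']; exact coarse_entry_le n Ψ' c (hΨ'd c) b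
  have hμ : 0 < μ := hν.trans hνμ
  have hNb : ∀ c, |N c c'| ≤ CN := fun c =>
    (hNd c c').trans (mul_le_of_le_one_right hCN (exp_le_one_iff.2 (neg_nonpos.2 (by positivity))))
  -- §1 for every `c`
  have hcoarse : ∀ c, Summable (fun b : X d => T' b' b * T b c) ∧ T b' c = T' b' c + (a' - a) * ∑' b : X d, T' b' b * T b c := by
    intro c
    have h := coupling_shift_coarse n a a' hε hγ hν hνμ V K hK Ψ hΨd hΨ Ψ' hΨ'd hΨ' hU b' c
    simp only [← hT, ← hT'] at h
    exact h
  -- the composed kernel `J(c) = Σ′_bT′(b′,b)T(b,c)` decays at rate `ν` (no-loss convolution)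
  have hT'ν : ∀ b, |T' b' b| ≤ CΨ' * exp (-(ν * ∑ i, (((b i - b' i).natAbs : ℕ) : ℝ))) := fun b => by
    rw [natAbs_sub_comm_sum]
    exact (hT'd b' b).trans (mul_le_mul_of_nonneg_left (exp_le_exp.2 (neg_le_neg (mul_le_mul_of_nonneg_right hνμ.le (hS0 _ _)))) hCΨ')
  have hJ : ∀ c, |∑' b : X d, T' b' b * T b c| ≤ CΨ' * CΨ * (2 * (1 - exp (-(μ - ν)))⁻¹) ^ d
      * exp (-(ν * ∑ i, (((c i - b' i).natAbs : ℕ) : ℝ))) := fun c =>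
    (conv_term_le (d := d) hν.le hνμ b' c (fun b => T' b' b) (fun b => T b c) hT'ν (fun b => by
      rw [natAbs_sub_comm_sum]; exact hTd b c)).2
  have hJb : ∀ c, |∑' b : X d, T' b' b * T b c| ≤ CΨ' * CΨ * (2 * (1 - exp (-(μ - ν)))⁻¹) ^ d := fun c => by
    have hK0 : 0 ≤ (2 * (1 - exp (-(μ - ν)))⁻¹) ^ d :=
      pow_nonneg (mul_nonneg zero_le_two (inv_nonneg.2 (sub_nonneg.2 (exp_le_one_iff.2 (by linarith))))) d
    exact (hJ c).trans (mul_le_of_le_one_right (by positivity) (exp_le_one_iff.2 (neg_nonpos.2 (by positivity))))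
  -- summabilities in `c`
  have hNc : ∀ c, |N c c'| ≤ CN * exp (-(νN * ∑ i, (((c' i - c i).natAbs : ℕ) : ℝ))) := fun c => by
    rw [natAbs_sub_comm_sum]; exact hNd c c'
  have hs1 : Summable fun c : X d => T b' c * N c c' := by
    refine Summable.of_norm_bounded (((summable_exp_l1 hνN c').mul_left CN).mul_left CΨ) fun c => ?_
    rw [Real.norm_eq_abs, abs_mul]
    have hTb : |T b' c| ≤ CΨ := (hTd b' c).trans (mul_le_of_le_one_right hCΨ (exp_le_one_iff.2 (neg_nonpos.2 (by positivity))))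
    calc |T b' c| * |N c c'| ≤ CΨ * (CN * exp (-(νN * ∑ i, (((c' i - c i).natAbs : ℕ) : ℝ)))) :=
          mul_le_mul hTb (hNc c) (abs_nonneg _) hCΨ
      _ = _ := by ring
  have hs2 : Summable fun c : X d => (∑' b : X d, T' b' b * T b c) * N c c' := by
    refine Summable.of_norm_bounded (((summable_exp_l1 hνN c').mul_left CN).mul_left
      (CΨ' * CΨ * (2 * (1 - exp (-(μ - ν)))⁻¹) ^ d)) fun c => ?_
    rw [Real.norm_eq_abs, abs_mul]
    calc |∑' b : X d, T' b' b * T b c| * |N c c'|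
        ≤ CΨ' * CΨ * (2 * (1 - exp (-(μ - ν)))⁻¹) ^ d * (CN * exp (-(νN * ∑ i, (((c' i - c i).natAbs : ℕ) : ℝ)))) :=
          mul_le_mul (hJb c) (hNc c) (abs_nonneg _) ((abs_nonneg _).trans (hJb c))
      _ = _ := by ring
  have hs3 : Summable fun c : X d => T' b' c * N c c' := by
    have e : ∀ c, T' b' c * N c c' = T b' c * N c c' - (a' - a) * ((∑' b : X d, T' b' b * T b c) * N c c') := fun c => by
      rw [(hcoarse c).2]; ring
    exact (hs1.sub (hs2.mul_left _)).congr fun c => (e c).symm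
  have hδ0 : ∀ c, c ≠ c' → T' b' c * ((a' - a) * (if c = c' then (1 : ℝ) else 0)) = 0 := fun c hc => by
    rw [if_neg hc, mul_zero, mul_zero]
  have hs4 : Summable fun c : X d => T' b' c * ((a' - a) * (if c = c' then (1 : ℝ) else 0)) :=
    summable_of_ne_finset_zero (s := {c'}) fun c hc => hδ0 c (fun h => hc (Finset.mem_singleton.2 h))
  -- re-association ((203)) and `T_aN = 1`
  have hTN' : ∀ b, ∑' c : X d, T b c * N c c' = if b = c' then 1 else 0 := fun b => by
    simp only [hT]; exact hTN b c'
  have hassoc : ∑' c : X d, (∑' b : X d, T' b' b * T b c) * N c c' = T' b' c' := by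
    rw [← kernel_comp_apply hμ hμ (fun b₁ b₂ => T' b₁ b₂) T hT'd hTd (fun c => N c c') hNb b']
    rw [tsum_congr fun b => by rw [hTN' b], tsum_eq_single c' (fun b hb => by rw [if_neg hb, mul_zero]), if_pos rfl, mul_one]
  -- assemble
  have e : ∀ c, T' b' c * (N c c' + (a' - a) * (if c = c' then 1 else 0))
      = T' b' c * N c c' + T' b' c * ((a' - a) * (if c = c' then 1 else 0)) := fun c => by ring
  have key : ∑' c : X d, T' b' c * N c c' = (if b' = c' then 1 else 0) - (a' - a) * T' b' c' := by
    have e2 : ∀ c, T' b' c * N c c' = T b' c * N c c' - (a' - a) * ((∑' b : X d, T' b' b * T b c) * N c c') := fun c => by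
      rw [(hcoarse c).2]; ring
    rw [tsum_congr e2, hs1.tsum_sub (hs2.mul_left _), tsum_mul_left, hTN' b', hassoc]
  simp only [hT'] at hs3 hs4 key e hδ0
  refine ⟨(hs3.add hs4).congr fun c => (e c).symm, ?_⟩
  rw [tsum_congr e, hs3.tsum_add hs4, key, tsum_eq_single c' hδ0, if_pos rfl, mul_one]
  ring

/-! ## §3. THE END: the next-scale Hessian shifts by `(a′ − a)·1` -/

/-- **HEADLINE — THE COUPLING IS AN ADDITIVE SHIFT OF THE NEXT-SCALE HESSIAN, `N_{a′} = N_a + (a′ − a)·1`.**  For every mesh `n`, ANY couplings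
`a, a′`, potential `V`, kernel `|K(p,q)| ≤ εe^{−γ|p−q|₁}`; block columns `Ψ` at `a` and `Ψ′` at `a′` (block profiles at rate `μ`, the displayed
equations), uniqueness of bounded solutions at `a′` ((237) (U)); a decaying right inverse `N` of `T_a` (`T_aN = 1`); and a decaying right inverse
`N′` of `T_{a′}` that is UNIQUE among decaying right inverses ((222) (C5)'s clause): `N′(b,c) = N(b,c) + (a′ − a)δ_{bc}` for all `b, c` — the
off-diagonal entries, hence every decay statement, of the next-scale Hessian do not depend on the coupling; the diagonal moves by `a′ − a`.
[folklore] -/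
theorem coupling_shift_inverse (n : ℕ) (a a' : ℝ) {ε γ μ ν CΨ CΨ' CN νN : ℝ} (hε : 0 ≤ ε) (hγ : 0 < γ) (hν : 0 < ν)
    (hνμ : ν < μ) (hνN : 0 < νN)
    (V : X d → ℝ) (K : X d → X d → ℝ) (hK : ∀ p q, |K p q| ≤ ε * exp (-(γ * ∑ i, (((p i - q i).natAbs : ℕ) : ℝ))))
    (Ψ : X d → X d → ℝ) (hΨd : ∀ c p, |Ψ c p| ≤ CΨ * exp (-(μ * ∑ i, (((blk n p i - c i).natAbs : ℕ) : ℝ))))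
    (hΨ : ∀ c p, ((n : ℝ) + 1) ^ 2 * ∑ μ', (2 * Ψ c p - Ψ c (p + e μ') - Ψ c (p - e μ'))
        + a / ((n : ℝ) + 1) ^ d * ∑ q ∈ B n (blk n p), Ψ c q + V p * Ψ c p + ∑' q : X d, K p q * Ψ c q
          = if blk n p = c then 1 else 0)
    (Ψ' : X d → X d → ℝ) (hΨ'd : ∀ c p, |Ψ' c p| ≤ CΨ' * exp (-(μ * ∑ i, (((blk n p i - c i).natAbs : ℕ) : ℝ))))
    (hΨ' : ∀ c p, ((n : ℝ) + 1) ^ 2 * ∑ μ', (2 * Ψ' c p - Ψ' c (p + e μ') - Ψ' c (p - e μ'))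
        + a' / ((n : ℝ) + 1) ^ d * ∑ q ∈ B n (blk n p), Ψ' c q + V p * Ψ' c p + ∑' q : X d, K p q * Ψ' c q
          = if blk n p = c then 1 else 0)
    (hU : ∀ (f : X d → ℝ) (Mf : ℝ), (∀ p, |f p| ≤ Mf) → ∀ (u v : X d → ℝ) (Bu Bv : ℝ), (∀ p, |u p| ≤ Bu) → (∀ p, |v p| ≤ Bv) →
        (∀ p, ((n : ℝ) + 1) ^ 2 * ∑ μ', (2 * u p - u (p + e μ') - u (p - e μ'))
          + a' / ((n : ℝ) + 1) ^ d * ∑ q ∈ B n (blk n p), u q + V p * u p + ∑' q : X d, K p q * u q = f p) →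
        (∀ p, ((n : ℝ) + 1) ^ 2 * ∑ μ', (2 * v p - v (p + e μ') - v (p - e μ'))
          + a' / ((n : ℝ) + 1) ^ d * ∑ q ∈ B n (blk n p), v q + V p * v p + ∑' q : X d, K p q * v q = f p) →
        ∀ p, u p = v p)
    (N : X d → X d → ℝ) (hNd : ∀ b c, |N b c| ≤ CN * exp (-(νN * ∑ i, (((b i - c i).natAbs : ℕ) : ℝ))))
    (hTN : ∀ b c', ∑' c : X d, ((((n : ℝ) + 1) ^ d)⁻¹ * ∑ q ∈ B n b, Ψ c q) * N c c' = if b = c' then 1 else 0)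
    (N' : X d → X d → ℝ)
    (hU' : ∀ (N'' : X d → X d → ℝ) (C' ν' : ℝ), 0 ≤ C' → 0 < ν' →
        (∀ b c, |N'' b c| ≤ C' * exp (-(ν' * ∑ i, (((b i - c i).natAbs : ℕ) : ℝ)))) →
        (∀ b c, ∑' b'' : X d, ((((n : ℝ) + 1) ^ d)⁻¹ * ∑ q ∈ B n b, Ψ' b'' q) * N'' b'' c = if b = c then 1 else 0) →
          ∀ b c, N'' b c = N' b c)
    (b c : X d) :
    N' b c = N b c + (a' - a) * (if b = c then 1 else 0) := by
  classical
  have hCN : 0 ≤ CN := by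
    have h := (abs_nonneg _).trans (hNd c c); exact le_of_mul_le_mul_right (by rw [zero_mul]; exact h) (exp_pos _)
  -- the shifted kernel decays at rate `ν_N` with constant `C_N + |a′ − a|`
  have hdec : ∀ b c, |N b c + (a' - a) * (if b = c then (1 : ℝ) else 0)|
      ≤ (CN + |a' - a|) * exp (-(νN * ∑ i, (((b i - c i).natAbs : ℕ) : ℝ))) := by
    intro b c
    refine (abs_add_le _ _).trans ?_
    rw [add_mul]
    refine add_le_add (hNd b c) ?_
    split_ifs with hbc
    · subst hbc; simp
    · rw [mul_zero, abs_zero]; positivity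
  have hright := fun b c' => (coupling_shift_right_inverse n a a' hε hγ hν hνμ hνN V K hK Ψ hΨd hΨ Ψ' hΨ'd hΨ' hU N hNd hTN b c').2
  exact (hU' (fun b c => N b c + (a' - a) * (if b = c then 1 else 0)) (CN + |a' - a|) νN (by positivity) hνN hdec hright b c).symm

/-! ## §4. Toy -/

/-- Toy (`d = 1`): the shifted kernel `N + (a′ − a)δ` of §3 has the SAME off-diagonal entries as `N` — at `b ≠ c` the shift vanishes. -/
example (N : X 1 → X 1 → ℝ) (a a' : ℝ) (b c : X 1) (hbc : b ≠ c) :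
    N b c + (a' - a) * (if b = c then 1 else 0) = N b c := by
  rw [if_neg hbc, mul_zero, add_zero]

end Summit.QuantumFields.BalabanUV.T4Continuum.NE7b.SupZdCouplingShift
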